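import Summits.ABC.IUTFork.Thm311RealInd1StripPacketUnionJunction
import HarnessLib

/-!
# [IUTchIII] Thm 3.11 (i) (Ind1)+(Ind2) ⟶ Cor 3.12, READING (U): the `ln ν̄_{𝕃_p}`-level UNION JUNCTION under the EXACT residue hypothesis
# (modulo `JannsenWingbergMappingClass`) — companion of `Thm311RealInd1StripPacketUnionJunction` (row «R23», p546301)

PROOF-ONLY file (abc-iut cell, Cor. 3.12 sub-crew, seat abc-iut-c312-1 = holder of record of the typed [IUTchIII] Thm. 3.11, gen 17; offer (ε)
«LNU-RESIDUE» of row «R23 C:UNION-JUNCTION»).  TAKES NO SIDE on [IUTchIII] Cor. 3.12.  No definition, no `Prop` fact; `JannsenWingbergMappingClass` is the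
only conditional input (binder `hMC`).

p546301 §3 states the `ln ν̄_{𝕃_p}`-level identity «reading (U) over print's (Ind1)⊔(Ind2) AS TYPED = `−|log(Θ)|_p`» with R21's residue hypothesis
`f(v̲|p) ≠ 1` at EVERY place of the section over `p`; p546301 §2 already has the hull identity per collection in the EXACT residue form of row R22 (β)
(`localFields_packetHull_orbitH_indOneUnion_pilotRegion_eq_possibleImagesHull_of_residue_of_jannsenWingbergMappingClass`: at a named content-minimising
slot `a₀`, `f ≠ 1` only at the RAMIFIED factors `b ≠ a₀`, and at `a₀` only when `e(v̲_{a₀}|p) ∣ v_{a₀}`).  This file assembles the latter over all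
collections:

* §1 **`localFields_lnνLp_hull_orbitH_indOneUnion_eq_negLogThetaAt_of_residue_of_jannsenWingbergMappingClass`** — every `v̲ ∣ p` of the section tame of
  odd local degree `≥ 3`; a valuation family `v(i,v⃗,a)` of the Θ-idele at every slot, a content-minimising slot family `a₀(i,v⃗)`, residue degree `≠ 1`
  required only at the RAMIFIED factors `b ≠ a₀(i,v⃗)` of each collection (`hram`) and at `a₀(i,v⃗)` only when `e ∣ v(i,v⃗,a₀)` (`hmin`); then for any
  family `H` with `H ≤ indTwo` containing the single-factor (Ind1) strip moves:
  `ln ν̄_{𝕃_p}(v⃗ ↦ hull(⋃_{g ∈ H_{v⃗}} g(⋃_σ σ·O_𝕃(−P_Θ)_{v⃗∘σ}))) = −|log(Θ)|_p` (`negLogThetaAt`, READING (U)); p546301 §3 is the case `hram`/`hmin`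
  vacuous (`f ≠ 1` everywhere);
* §2 input level **`ThetaVolumeInput.lnνLp_hull_orbitH_indOneUnion_eq_negLogThetaLoc_of_residue_of_jannsenWingbergMappingClass`**.
HONEST SCOPE as in R21–R23: OUR typings (THE equivariant lift, THE logarithm, factorwise action; (Ind1) = factor permutations + the strip part as typed;
F-B28-1 untouched); conditional on `hMC`; residues that REMAIN: a factor of residue degree `1` (then totally tamely ramified, `e = [K_v:ℚ_p] ≥ 3`) off the
minimising slot of some collection, or at it with `e ∣ ord t` (the depth-`e` bit); EVEN local degree (NOT typed); WILD; `p = 2`; equal-AS-TYPED ≠ equal in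
print; nothing here asserts that abc is proved or refuted; no side taken on (U) vs (P) or on any author. [claim: Mochizuki2012, status: disputed];
[cite: Mochizuki2012, IUTchIII Thm. 3.11 (i) p. 154; Cor. 3.12 p. 174, proof Steps (x)/(xi) pp. 180–183]; [cite: Kondo2025OuterAutMLF, §3 Thm 3.17, Rem 3.18];
[cite: DupuyHilado2025, §4.7, §4.9, §4.11, §4.12]. typed ≠ proved; a conditional theorem discharges nothing it binds.
-/

set_option autoImplicit false

noncomputable section

open Metric Set Function
open scoped Pointwise TensorProduct

namespace Summit.ABC.IUTFork.Thm311.Real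

open NumberField IsDedekindDomain Literature.NumberTheory.NumberFields Literature.IUT.LogVolume
open Literature.NumberTheory.GaloisRepresentations Literature.NumberTheory.GaloisRepresentations.Ultrametric
open Literature.AnabelianGeometry.AbsoluteAnabelian Literature.IUT.HodgeArakelov
open Literature.IUT.HodgeArakelov.AbsTopMonoids

/-! ## §1 The `ln ν̄_{𝕃_p}`-level identity with `−|log(Θ)|_p` (reading (U)) under the exact residue hypothesis -/

section PlaceSection

variable {F₀ : Type} [Field F₀] [NumberField F₀] {K : Type} [Field K] [NumberField K] [Algebra F₀ K]
variable (σ : PlaceSection F₀ K) (p : ℕ) [hp : Fact p.Prime]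
variable (c : (j : ℕ) → (Fin (j + 1) → placesOver F₀ p) → ℚ_[p]) (hc0 : ∀ j e, c j e ≠ 0)
  (hcσ : ∀ (j : ℕ) (τ : Equiv.Perm (Fin (j + 1))) (e : Fin (j + 1) → placesOver F₀ p), c j (e ∘ τ) = c j e)

/-- **READING (U) OVER PRINT's (Ind1)⊔(Ind2) AS TYPED EQUALS `−|log(Θ)|_p`, exact residue form (modulo `JannsenWingbergMappingClass`).**  Real prime
packet over the genuine completions of a place section (any shell normalisation `c`); every `v̲ ∣ p` of the section tame of odd local degree `≥ 3`; a
Θ-idele `t` with slot valuations `‖t_{i,v_a}‖ = p^{−v(i,v⃗,a)/e(v̲_a|p)}`; a content-minimising slot `a₀(i,v⃗)` of every collection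
(`(v(i,v⃗,a₀) − 1) div e(v̲_{a₀}|p) ≤ (v(i,v⃗,a) − 1) div e(v̲_a|p)`); residue degree `≠ 1` at the RAMIFIED factors `b ≠ a₀(i,v⃗)` (`hram`), and at
`a₀(i,v⃗)` only when `e(v̲_{a₀}|p) ∣ v(i,v⃗,a₀)` (`hmin`).  Then for any family `H = (H_{j,v⃗})` of subgroups of the packet automorphisms with
`H_{j,v⃗} ≤ indTwo` containing the single-factor (Ind1) strip moves in the degrees `j = i+1 ≤ ℓ⋆`:
`ln ν̄_{𝕃_p}(v⃗ ↦ hull(⋃_{g ∈ H_{v⃗}} g(⋃_σ σ·O_𝕃(−P_Θ)_{v⃗∘σ}))) = −|log(Θ)|_p` (`negLogThetaAt`, the hull of the union of ALL possible images).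
[claim: Mochizuki2012, status: disputed] [cite: Mochizuki2012, IUTchIII Thm. 3.11 (i) p. 154; Cor. 3.12 p. 174]
[cite: Kondo2025OuterAutMLF, §3 Thm 3.17, Rem 3.18] [cite: DupuyHilado2025, §4.7, §4.9, §4.11, §4.12] -/
theorem localFields_lnνLp_hull_orbitH_indOneUnion_eq_negLogThetaAt_of_residue_of_jannsenWingbergMappingClass
    (hMC : JannsenWingbergMappingClass) (hp2 : 2 < p) {lstar : ℕ}
    (t : Fin lstar → (v : placesOver F₀ p) → ((σ.localFields p).k v)ˣ)
    (he : ∀ v : placesOver F₀ p, absRamificationIdx p ((σ.localFields p).k v) ≤ p - 2)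
    (h3 : ∀ v : placesOver F₀ p, 3 ≤ localDeg K (σ.lift v.1)) (hodd : ∀ v : placesOver F₀ p, Odd (localDeg K (σ.lift v.1)))
    (v : (i : Fin lstar) → (Fin ((i : ℕ) + 1 + 1) → placesOver F₀ p) → Fin ((i : ℕ) + 1 + 1) → ℤ)
    (hv : ∀ (i : Fin lstar) (e : Fin ((i : ℕ) + 1 + 1) → placesOver F₀ p) (a : Fin ((i : ℕ) + 1 + 1)),
      ‖(t i (e a) : (σ.localFields p).k (e a))‖ =
        (p : ℝ) ^ (-(v i e a / (absRamificationIdx p ((σ.localFields p).k (e a)) : ℝ))))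
    (a₀ : (i : Fin lstar) → (Fin ((i : ℕ) + 1 + 1) → placesOver F₀ p) → Fin ((i : ℕ) + 1 + 1))
    (ha₀ : ∀ (i : Fin lstar) (e : Fin ((i : ℕ) + 1 + 1) → placesOver F₀ p) (a : Fin ((i : ℕ) + 1 + 1)),
      (v i e (a₀ i e) - 1) / (absRamificationIdx p ((σ.localFields p).k (e (a₀ i e))) : ℤ) ≤
        (v i e a - 1) / (absRamificationIdx p ((σ.localFields p).k (e a)) : ℤ))
    (hram : ∀ (i : Fin lstar) (e : Fin ((i : ℕ) + 1 + 1) → placesOver F₀ p) (b : Fin ((i : ℕ) + 1 + 1)), b ≠ a₀ i e →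
      absRamificationIdx p ((σ.localFields p).k (e b)) ≠ 1 → (σ.lift (e b).1).asIdeal.inertiaDeg ℤ ≠ 1)
    (hmin : ∀ (i : Fin lstar) (e : Fin ((i : ℕ) + 1 + 1) → placesOver F₀ p),
      (σ.lift (e (a₀ i e)).1).asIdeal.inertiaDeg ℤ = 1 →
        ¬ ((absRamificationIdx p ((σ.localFields p).k (e (a₀ i e))) : ℤ) ∣ v i e (a₀ i e)))
    (H : (j : ℕ) → (e : Fin (j + 1) → placesOver F₀ p) →
      Subgroup (PacketAlgebra p (fun b => (σ.localFields p).k (e b)) ≃ₗ[ℚ_[p]]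
        PacketAlgebra p (fun b => (σ.localFields p).k (e b))))
    (hH : ∀ j e, H j e ≤ indTwo p (fun b => (σ.localFields p).k (e b)))
    (hstrip : ∀ (i : Fin lstar) (e : Fin ((i : ℕ) + 1 + 1) → placesOver F₀ p) (b₀ : Fin ((i : ℕ) + 1 + 1)),
      ∀ ψ ∈ ind1StripOf (σ.lift (e b₀).1) (galoisLog (σ.lift (e b₀).1)), ∃ γ ∈ H ((i : ℕ) + 1) e,
        ∀ z : ∀ b, (σ.localFields p).k (e b),
          (γ : PacketAlgebra p (fun b => (σ.localFields p).k (e b)) ≃ₗ[ℚ_[p]]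
              PacketAlgebra p (fun b => (σ.localFields p).k (e b))) (PiTensorProduct.tprod ℚ_[p] z) =
            PiTensorProduct.tprod ℚ_[p] (update z b₀
              (RescaledCompletion.of K p (σ.lift (e b₀).1) (σ.natCast_mem_lift (e b₀))
                (ψ ((RescaledCompletion.of K p (σ.lift (e b₀).1) (σ.natCast_mem_lift (e b₀))).symm (z b₀)))))) :
    (realPrimePacketWith p (σ.localFields p) c hc0 hcσ).lnνLp lstar (fun j e =>
        packetHull p (fun b => (σ.localFields p).k (e b))
          (⋃ g : H j e, (g : PacketAlgebra p (fun b => (σ.localFields p).k (e b)) ≃ₗ[ℚ_[p]]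
              PacketAlgebra p (fun b => (σ.localFields p).k (e b))) ''
            ⋃ τ : Equiv.Perm (Fin (j + 1)), (realPrimePacketWith p (σ.localFields p) c hc0 hcσ).perm τ e ''
              (realPrimePacketWith p (σ.localFields p) c hc0 hcσ).pilotRegion t j (e ∘ τ))) =
      (realPrimePacketWith p (σ.localFields p) c hc0 hcσ).negLogThetaAt lstar t := by
  unfold PrimePacket.negLogThetaAt
  refine (realPrimePacketWith p (σ.localFields p) c hc0 hcσ).lnνLp_congr_of_succ lstar fun i e => ?_
  exact localFields_packetHull_orbitH_indOneUnion_pilotRegion_eq_possibleImagesHull_of_residue_of_jannsenWingbergMappingClass σ p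
    c hc0 hcσ hMC hp2 t i e (fun b => he (e b)) (fun b => h3 (e b)) (fun b => hodd (e b)) (v i e) (hv i e) (a₀ i e) (ha₀ i e)
    (hram i e) (hmin i e) (H _ e) (hH _ e) (hstrip i e)

/-- p546301 §3's hypothesis «`f(v̲|p) ≠ 1` at EVERY place of the section over `p`» implies the exact residue hypotheses `hram`/`hmin` of
`localFields_lnνLp_hull_orbitH_indOneUnion_eq_negLogThetaAt_of_residue_of_jannsenWingbergMappingClass` for ANY valuation family and ANY slot family
(trivially); so the `_of_residue_` theorem STRENGTHENS p546301 §3 (a content-minimising slot exists in every collection: `Finset.exists_mem_eq_inf'`).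
[cite: Mochizuki2012, IUTchIII Thm. 3.11 (i) p. 154] -/
theorem hram_hmin_of_inertiaDeg_ne_one {lstar : ℕ}
    (hf : ∀ v : placesOver F₀ p, (σ.lift v.1).asIdeal.inertiaDeg ℤ ≠ 1)
    (v : (i : Fin lstar) → (Fin ((i : ℕ) + 1 + 1) → placesOver F₀ p) → Fin ((i : ℕ) + 1 + 1) → ℤ)
    (a₀ : (i : Fin lstar) → (Fin ((i : ℕ) + 1 + 1) → placesOver F₀ p) → Fin ((i : ℕ) + 1 + 1)) :
    (∀ (i : Fin lstar) (e : Fin ((i : ℕ) + 1 + 1) → placesOver F₀ p) (b : Fin ((i : ℕ) + 1 + 1)), b ≠ a₀ i e →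
        absRamificationIdx p ((σ.localFields p).k (e b)) ≠ 1 → (σ.lift (e b).1).asIdeal.inertiaDeg ℤ ≠ 1) ∧
      (∀ (i : Fin lstar) (e : Fin ((i : ℕ) + 1 + 1) → placesOver F₀ p),
        (σ.lift (e (a₀ i e)).1).asIdeal.inertiaDeg ℤ = 1 →
          ¬ ((absRamificationIdx p ((σ.localFields p).k (e (a₀ i e))) : ℤ) ∣ v i e (a₀ i e))) :=
  ⟨fun _ e b _ _ => hf (e b), fun _ e h => absurd h (hf (e _))⟩

end PlaceSection

end Summit.ABC.IUTFork.Thm311.Real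

/-! ## §2 Input level: the `p`-summand of `−|log(Θ)|` (reading (U)) of a genuine Θ-volume input, exact residue form -/

namespace Literature.IUT.LogVolume.ThetaVolumeInput

open Summit.ABC.IUTFork.Thm311.Real Literature.NumberTheory.NumberFields Function

variable {F₀ : Type} [Field F₀] [NumberField F₀] {K : Type} [Field K] [NumberField K] [Algebra F₀ K]
variable (I : ThetaVolumeInput F₀ K)

/-- **INPUT LEVEL, reading (U), exact residue form.**  For a genuine Θ-volume input `I` and a prime `p > 2` over which every place of the section is
tame of odd local degree `≥ 3`, with `v(i,v⃗,a)` the slot valuations of `t_Θ`, a content-minimising slot family `a₀(i,v⃗)`, residue degree `≠ 1` at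
the ramified factors off `a₀(i,v⃗)` and at `a₀(i,v⃗)` only when `e ∣ v(i,v⃗,a₀)`: the `p`-summand of `−|log(Θ)|` (`negLogThetaLoc I p`, reading (U),
Mochizuki's shell normalisation) EQUALS the reading computed over any family `H` of subgroups of the packet automorphisms with `H ≤ indTwo` containing
the single-factor (Ind1) strip moves — modulo `JannsenWingbergMappingClass`. [claim: Mochizuki2012, status: disputed]
[cite: Mochizuki2012, IUTchIII Cor. 3.12 p. 174] [cite: DupuyHilado2025, §4.11, §4.12] -/
theorem lnνLp_hull_orbitH_indOneUnion_eq_negLogThetaLoc_of_residue_of_jannsenWingbergMappingClass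
    (hMC : Literature.AnabelianGeometry.AbsoluteAnabelian.JannsenWingbergMappingClass) {p : ℕ} (hp : p.Prime) (hp2 : 2 < p)
    (he : haveI : Fact p.Prime := ⟨hp⟩; ∀ v : placesOver F₀ p, absRamificationIdx p ((I.σ.localFields p).k v) ≤ p - 2)
    (h3 : haveI : Fact p.Prime := ⟨hp⟩; ∀ v : placesOver F₀ p, 3 ≤ localDeg K (I.σ.lift v.1))
    (hodd : haveI : Fact p.Prime := ⟨hp⟩; ∀ v : placesOver F₀ p, Odd (localDeg K (I.σ.lift v.1)))
    (v : haveI : Fact p.Prime := ⟨hp⟩; (i : Fin I.lstar) → (Fin ((i : ℕ) + 1 + 1) → placesOver F₀ p) → Fin ((i : ℕ) + 1 + 1) → ℤ)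
    (hv : haveI : Fact p.Prime := ⟨hp⟩; ∀ (i : Fin I.lstar) (e : Fin ((i : ℕ) + 1 + 1) → placesOver F₀ p) (a : Fin ((i : ℕ) + 1 + 1)),
      ‖(I.tΘ p hp i (e a) : (I.σ.localFieldFamily p hp).k (e a))‖ =
        (p : ℝ) ^ (-(v i e a / (absRamificationIdx p ((I.σ.localFieldFamily p hp).k (e a)) : ℝ))))
    (a₀ : haveI : Fact p.Prime := ⟨hp⟩; (i : Fin I.lstar) → (Fin ((i : ℕ) + 1 + 1) → placesOver F₀ p) → Fin ((i : ℕ) + 1 + 1))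
    (ha₀ : haveI : Fact p.Prime := ⟨hp⟩; ∀ (i : Fin I.lstar) (e : Fin ((i : ℕ) + 1 + 1) → placesOver F₀ p) (a : Fin ((i : ℕ) + 1 + 1)),
      (v i e (a₀ i e) - 1) / (absRamificationIdx p ((I.σ.localFields p).k (e (a₀ i e))) : ℤ) ≤
        (v i e a - 1) / (absRamificationIdx p ((I.σ.localFields p).k (e a)) : ℤ))
    (hram : haveI : Fact p.Prime := ⟨hp⟩; ∀ (i : Fin I.lstar) (e : Fin ((i : ℕ) + 1 + 1) → placesOver F₀ p) (b : Fin ((i : ℕ) + 1 + 1)),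
      b ≠ a₀ i e → absRamificationIdx p ((I.σ.localFields p).k (e b)) ≠ 1 → (I.σ.lift (e b).1).asIdeal.inertiaDeg ℤ ≠ 1)
    (hmin : haveI : Fact p.Prime := ⟨hp⟩; ∀ (i : Fin I.lstar) (e : Fin ((i : ℕ) + 1 + 1) → placesOver F₀ p),
      (I.σ.lift (e (a₀ i e)).1).asIdeal.inertiaDeg ℤ = 1 →
        ¬ ((absRamificationIdx p ((I.σ.localFields p).k (e (a₀ i e))) : ℤ) ∣ v i e (a₀ i e)))
    (H : haveI : Fact p.Prime := ⟨hp⟩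
      (j : ℕ) → (e : Fin (j + 1) → placesOver F₀ p) →
        Subgroup (PacketAlgebra p (fun b => (I.σ.localFields p).k (e b)) ≃ₗ[ℚ_[p]]
          PacketAlgebra p (fun b => (I.σ.localFields p).k (e b))))
    (hH : haveI : Fact p.Prime := ⟨hp⟩; ∀ j e, H j e ≤ indTwo p (fun b => (I.σ.localFields p).k (e b)))
    (hstrip : haveI : Fact p.Prime := ⟨hp⟩
      ∀ (i : Fin I.lstar) (e : Fin ((i : ℕ) + 1 + 1) → placesOver F₀ p) (b₀ : Fin ((i : ℕ) + 1 + 1)),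
        ∀ ψ ∈ ind1StripOf (I.σ.lift (e b₀).1) (galoisLog (I.σ.lift (e b₀).1)), ∃ γ ∈ H ((i : ℕ) + 1) e,
          ∀ z : ∀ b, (I.σ.localFields p).k (e b),
            (γ : PacketAlgebra p (fun b => (I.σ.localFields p).k (e b)) ≃ₗ[ℚ_[p]]
                PacketAlgebra p (fun b => (I.σ.localFields p).k (e b))) (PiTensorProduct.tprod ℚ_[p] z) =
              PiTensorProduct.tprod ℚ_[p] (update z b₀
                (RescaledCompletion.of K p (I.σ.lift (e b₀).1) (I.σ.natCast_mem_lift (e b₀))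
                  (ψ ((RescaledCompletion.of K p (I.σ.lift (e b₀).1) (I.σ.natCast_mem_lift (e b₀))).symm (z b₀)))))) :
    haveI : Fact p.Prime := ⟨hp⟩
    (I.packetAt p hp).lnνLp I.lstar (fun j e =>
        packetHull p (fun b => (I.σ.localFields p).k (e b))
          (⋃ g : H j e, (g : PacketAlgebra p (fun b => (I.σ.localFields p).k (e b)) ≃ₗ[ℚ_[p]]
              PacketAlgebra p (fun b => (I.σ.localFields p).k (e b))) ''
            ⋃ τ : Equiv.Perm (Fin (j + 1)), (I.packetAt p hp).perm τ e '' (I.packetAt p hp).pilotRegion (I.tΘ p hp) j (e ∘ τ))) =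
      I.negLogThetaLoc p := by
  haveI : Fact p.Prime := ⟨hp⟩
  rw [negLogThetaLoc_of_prime I hp]
  exact localFields_lnνLp_hull_orbitH_indOneUnion_eq_negLogThetaAt_of_residue_of_jannsenWingbergMappingClass I.σ p (mScale p (I.σ.localFields p))
    (mScale_ne_zero p (I.σ.localFields p)) (mScale_perm p (I.σ.localFields p)) hMC hp2 (I.tΘ p hp) he h3 hodd v hv a₀ ha₀ hram hmin H hH hstrip

end Literature.IUT.LogVolume.ThetaVolumeInput

end
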